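import Summits.CriticalPhenomena.Ising3DConformalLimit.Theses.LocalisationClock
import Summits.CriticalPhenomena.Ising3DConformalLimit.Theorems.LeeYangGapGaussianLimitKillsBlockCouplingBlockSums
import HarnessLib

/-!
# Birth skeleton (BC3) for the crux `LocalisationClock.GaussianLimitKillsBlockCoupling`
(item stmt-CriticalPhenomena-15886, rank 9 — the SHARED transfer glue of route `LocalisationClock`,
byte-identical to the PROVED LeeYangGap item stmt-CriticalPhenomena-4950)

The crux (GLKB): for every renormalisation `ρ > 0` on `(0,1]`, `Δ` and `S`, if `S` is a pointwise scaling
limit of `criticalCorr 3` with non-degenerate two-point function, scale covariant with dimension `Δ` and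
with `U₄^S ≡ 0` on non-coincident configurations, then the block Binder coupling of the critical `+` state
on `ℤ³`, `g_L = (3⟨M_L²⟩² − ⟨M_L⁴⟩)/⟨M_L²⟩²` (`M_L = Σ_{x ∈ Λ_L} σ_x`), tends to `0`.

## The line (Aizenman's dimension count for block sums, CDM 2020 §10.1 — the anatomy of the in-tree proof
`LeeYangGapGaussianLimitKillsBlockCoupling.gaussianLimitKillsBlockCoupling_proof` of the twin item 4950)

`3⟨M_L²⟩² − ⟨M_L⁴⟩ = −Σ_{Λ_L⁴} U₄^{lat}` (tree: `three_mul_sq_sub_fourth_eq_neg_sum_ursellFour`). Split `Λ_L⁴` at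
sup-distance `n = ⌊ηL⌋`:

* `stub_nearFarPairingSplit` (M; correlation inequalities): the NEAR/FAR SPLIT of `Σ_{Λ_L⁴}|U₄^{lat}|` — near
  quadruples (some pair at sup-distance `≤ n`) are bounded through the Lebowitz–Griffiths pairing bound
  `|U₄(a,b,c,e)| ≤ 2⟨σ_aσ_b⟩⟨σ_cσ_e⟩` for the pairing containing the close pair (Aizenman–Duminil-Copin 2021
  eq. (3.12)) and an abstract row-sum bound `X` on `Σ_{‖v−u‖_∞ ≤ n}⟨σ_uσ_v⟩`; far quadruples by an abstract `M`:
  `Σ|U₄| ≤ 12|Λ_L|·X·Σ_L + |Λ_L|⁴·M`.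
* `stub_shortDistanceNonDomination` (L; the regular-variation input the crux's "why it might fail" names):
  under the crux hypotheses minus Gaussianity, for every `ε > 0` there is `η ∈ (0,1]` with
  `χ(⌊ηL⌋) ≤ ε·χ(L/2)` for all large `L`, `χ(m) = Σ_{z ∈ Λ_m}⟨σ₀σ_z⟩_{β_c}` — short distances do not dominate
  the box susceptibility (scale covariance with `Δ ≤ 1` makes the axis two-point function dyadically doubling;
  Messager–Miracle-Solé shells; a discrete Potter bound of index `log₂ 5 < 3`).
* `stub_farUrsellVanishing` (M; the only place Gaussianity `U₄^S ≡ 0` is spent): along `δ = 1/L`, for all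
  large `L`, `ρ(1/L)⁴|U₄^{lat}(y)| ≤ ε` simultaneously for all quadruples `y ⊆ Λ_L` at mutual sup-distances
  `> ηL` (locally uniform convergence is uniform on the compact far region, where `U₄^S = 0`).

`GaussianLimitKillsBlockCoupling_of_hyps` is the REAL composition (sorry-free): the three stub STATEMENTS as
hypotheses ⟹ the crux's definiens, via the tree's block-sum bookkeeping (`rowSum_le_boxSum`,
`card_mul_boxSum_le_blockSum : |Λ_{L/2}|χ(L/2) ≤ Σ_L`, `card_sq_mul_axis_le_blockSum : |Λ_{L/2}|²G(2Le₁) ≤ Σ_L`,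
`tendsto_renorm_sq_mul_axis_two : ρ(1/L)²G(2Le₁) → S₂(0,2e) > 0`) and the real arithmetic `birth_arith`
(near`/Σ_L² ≤ ε/4`, far`/Σ_L² ≤ ε/4`). `GaussianLimitKillsBlockCoupling_of : GaussianLimitKillsBlockCoupling` feeds it
the three declared stubs and concludes the crux BY NAME (the `#h21_check_skeleton` shape: no hypotheses,
`sorry` only inside the three `stub_*`).

Each stub is dischargeable from the tree at once (registrar's sanity file `bc/stub_discharge.lean`, rc 0, no
sorry): `sum_abs_ursellFour_le_of_rowSum (d := 3) le_rfl`, `exists_eta_boxSum_floor_le`,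
`eventually_forall_far_rescaled_ursellFour_le (d := 3) le_rfl` — the crux is REPAIRABLE-bin bookkeeping, not an
open problem; this file only certifies its anatomy (BC3).
-/

noncomputable section

namespace Summit.CriticalPhenomena.Ising3DConformalLimit.Cruxes.GaussianLimitKillsBlockCoupling.Birth

open Filter Set Finset
open scoped BigOperators Topology
open Literature.Probability.LatticeModels
open Summit.CriticalPhenomena.Ising3DConformalLimit.LeeYangGapGaussianLimitKillsBlockCoupling

/-! ### Stub 1 — the near/far split with the Lebowitz–Griffiths pairing bound -/

/-- **Stub 1 (near/far split of `Σ_{Λ_L⁴}|U₄^{lat}|` at `β_c` on `ℤ³`).** For every `L n : ℕ` and reals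
`X`, `M ≥ 0`: if every row sum `Σ_{v ∈ Λ_L, ‖v−u‖_∞ ≤ n}⟨σ_uσ_v⟩_{β_c}` is `≤ X` and `|U₄^{lat}(a,b,c,e)| ≤ M`
for all `a,b,c,e ∈ Λ_L` at mutual sup-distances `> n`, then
`Σ_{Λ_L⁴}|U₄^{lat}| ≤ 12·|Λ_L|·X·Σ_{a,b ∈ Λ_L}⟨σ_aσ_b⟩_{β_c} + |Λ_L|⁴·M`. The near part is where the
correlation inequalities enter: `|U₄(a,b,c,e)| ≤ 2⟨σ_aσ_b⟩⟨σ_cσ_e⟩` for the pairing containing the close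
pair (Lebowitz `U₄ ≤ 0` + Griffiths II; Aizenman–Duminil-Copin 2021 eq. (3.12)).
[cite: AizenmanDuminilCopinAnnals2021, eq. (3.12)] [cite: AizenmanCDM2020, §10.1] -/
theorem stub_nearFarPairingSplit :
    ∀ (L n : ℕ) (X M : ℝ), 0 ≤ M →
      (∀ u : Literature.Probability.LatticeModels.Site 3,
        ∑ v ∈ (Literature.Probability.LatticeModels.box 3 L).filter (fun v => Literature.Probability.LatticeModels.Site.supNorm (v - u) ≤ n),
          Literature.Probability.LatticeModels.criticalCorr 3 2 ![u, v] ≤ X) →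
      (∀ a ∈ Literature.Probability.LatticeModels.box 3 L, ∀ b ∈ Literature.Probability.LatticeModels.box 3 L, ∀ c ∈ Literature.Probability.LatticeModels.box 3 L, ∀ e ∈ Literature.Probability.LatticeModels.box 3 L,
        n < Literature.Probability.LatticeModels.Site.supNorm (b - a) → n < Literature.Probability.LatticeModels.Site.supNorm (e - c) →
        n < Literature.Probability.LatticeModels.Site.supNorm (c - a) → n < Literature.Probability.LatticeModels.Site.supNorm (e - b) →
        n < Literature.Probability.LatticeModels.Site.supNorm (e - a) → n < Literature.Probability.LatticeModels.Site.supNorm (c - b) →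
        |Literature.Probability.LatticeModels.criticalCorr 3 4 ![a, b, c, e] -
          (Literature.Probability.LatticeModels.criticalCorr 3 2 ![a, b] * Literature.Probability.LatticeModels.criticalCorr 3 2 ![c, e] +
            Literature.Probability.LatticeModels.criticalCorr 3 2 ![a, c] * Literature.Probability.LatticeModels.criticalCorr 3 2 ![b, e] +
            Literature.Probability.LatticeModels.criticalCorr 3 2 ![a, e] * Literature.Probability.LatticeModels.criticalCorr 3 2 ![b, c])| ≤ M) →
      ∑ a ∈ Literature.Probability.LatticeModels.box 3 L, ∑ b ∈ Literature.Probability.LatticeModels.box 3 L, ∑ c ∈ Literature.Probability.LatticeModels.box 3 L, ∑ e ∈ Literature.Probability.LatticeModels.box 3 L,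
          |Literature.Probability.LatticeModels.criticalCorr 3 4 ![a, b, c, e] -
          (Literature.Probability.LatticeModels.criticalCorr 3 2 ![a, b] * Literature.Probability.LatticeModels.criticalCorr 3 2 ![c, e] +
            Literature.Probability.LatticeModels.criticalCorr 3 2 ![a, c] * Literature.Probability.LatticeModels.criticalCorr 3 2 ![b, e] +
            Literature.Probability.LatticeModels.criticalCorr 3 2 ![a, e] * Literature.Probability.LatticeModels.criticalCorr 3 2 ![b, c])| ≤
        12 * ((Finset.card (Literature.Probability.LatticeModels.box 3 L) : ℝ) * X) *
            (∑ a ∈ Literature.Probability.LatticeModels.box 3 L, ∑ b ∈ Literature.Probability.LatticeModels.box 3 L, Literature.Probability.LatticeModels.criticalCorr 3 2 ![a, b]) +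
          (Finset.card (Literature.Probability.LatticeModels.box 3 L) : ℝ) ^ 4 * M := by
  sorry

/-! ### Stub 2 — short distances do not dominate the box susceptibility (doubling / Potter bound) -/

/-- **Stub 2 (no short-distance domination of `χ`).** For a pointwise scaling limit `S` of `criticalCorr 3`
with renormalisation `ρ > 0` on `(0,1]`, non-degenerate two-point function and scale covariance of
dimension `Δ`: for every `ε > 0` there is `η ∈ (0,1]` such that `χ(⌊ηL⌋) ≤ ε·χ(L/2)` for all large `L`,
where `χ(m) = Σ_{z ∈ Λ_m}⟨σ₀σ_z⟩_{β_c}`. (Scale covariance forces `Δ ≤ 1` and dyadic doubling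
`G(2^j e₁) ≤ 5·G(2^{j+1} e₁)` of the axis two-point function; Messager–Miracle-Solé sphere sandwich turns it
into geometric growth of the dyadic shells of `χ` — a discrete Potter bound of index `log₂ 5 < 3`, the
regular-variation input named in the crux's "why it might fail".)
[cite: DuminilCopin2019, Thm. 4.8 and §4.4] [cite: MessagerMiracleSoleJSP1977] -/
theorem stub_shortDistanceNonDomination :
    ∀ (ρ : ℝ → ℝ) (Δ : ℝ) (S : Literature.Probability.LatticeModels.CorrFamily 3), (∀ δ ∈ Set.Ioc (0:ℝ) 1, 0 < ρ δ) →
      Literature.Probability.LatticeModels.HasPointwiseScalingLimit (Literature.Probability.LatticeModels.criticalCorr 3) ρ S →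
      Literature.Probability.LatticeModels.IsNondegenerateTwoPoint S → Literature.Probability.LatticeModels.IsScaleCovariant Δ S →
      ∀ ε : ℝ, 0 < ε → ∃ η : ℝ, 0 < η ∧ η ≤ 1 ∧ ∀ᶠ L : ℕ in Filter.atTop,
        ∑ z ∈ Literature.Probability.LatticeModels.box 3 ⌊η * L⌋₊, Literature.Probability.LatticeModels.criticalTwoPoint 3 z ≤
          ε * ∑ z ∈ Literature.Probability.LatticeModels.box 3 (L / 2), Literature.Probability.LatticeModels.criticalTwoPoint 3 z := by
  sorry

/-! ### Stub 3 — far quadruples of a block under a Gaussian limit -/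

/-- **Stub 3 (uniform smallness of the rescaled Ursell function on far block quadruples, Gaussian case).**
For a pointwise scaling limit `S` of `criticalCorr 3` with renormalisation `ρ` and `U₄^S ≡ 0` on
non-coincident configurations, and `η, ε > 0`: for all large `L`, every quadruple `y` of sites of `Λ_L` at
mutual sup-distances `> ηL` has `ρ(1/L)⁴·|U₄^{lat}(y)| ≤ ε` (the rescaled far configurations range in a
compact set of non-coincident quadruples, on which `ρ(δ)⁴U₄^{lat}([z/δ]) → U₄^S = 0` uniformly, and
`[z/(1/L)] = y` exactly). The only stub that spends Gaussianity.
[cite: AizenmanCDM2020, §10.1 eqs. (10.1)–(10.2)] -/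
theorem stub_farUrsellVanishing :
    ∀ (ρ : ℝ → ℝ) (S : Literature.Probability.LatticeModels.CorrFamily 3),
      Literature.Probability.LatticeModels.HasPointwiseScalingLimit (Literature.Probability.LatticeModels.criticalCorr 3) ρ S → ¬ Literature.Probability.LatticeModels.HasNontrivialU4 S →
      ∀ η ε : ℝ, 0 < η → 0 < ε →
      ∀ᶠ L : ℕ in Filter.atTop, ∀ y : Fin 4 → Literature.Probability.LatticeModels.Site 3, (∀ i, y i ∈ Literature.Probability.LatticeModels.box 3 L) →
        (∀ i j, i ≠ j → η * L < Literature.Probability.LatticeModels.Site.supNorm (y i - y j)) →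
        ρ (1 / (L : ℝ)) ^ 4 * |Literature.Probability.LatticeModels.criticalCorr 3 4 y -
          (Literature.Probability.LatticeModels.criticalCorr 3 2 ![y 0, y 1] * Literature.Probability.LatticeModels.criticalCorr 3 2 ![y 2, y 3]
            + Literature.Probability.LatticeModels.criticalCorr 3 2 ![y 0, y 2] * Literature.Probability.LatticeModels.criticalCorr 3 2 ![y 1, y 3]
            + Literature.Probability.LatticeModels.criticalCorr 3 2 ![y 0, y 3] * Literature.Probability.LatticeModels.criticalCorr 3 2 ![y 1, y 2])| ≤ ε := by
  sorry

/-! ### Real arithmetic of the near/far assembly -/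

/-- The real arithmetic of the near/far assembly: with `N ≤ 27L³` sites, `N₂ ≥ L³` sites in the half
box, row-sum bound `X ≤ ε χ₂/1296`, block sum `Sg ≥ N₂ χ₂` and `Sg ≥ N₂² g` with `ρ₂ g ≥ s/2`, and far
bound `M = ε s² ρ₂⁻²/(16·27⁴)`, the near/far majorant is `≤ (ε/2) Sg²`. -/
theorem birth_arith {ε s Lr N N2 Sg χ2 X g ρ2 M T : ℝ} (hε : 0 < ε) (hs : 0 < s) (hLr : 1 ≤ Lr)
    (hN0 : 0 ≤ N) (hN : N ≤ 27 * Lr ^ 3) (hN2 : Lr ^ 3 ≤ N2) (hχ2 : 0 ≤ χ2) (hX0 : 0 ≤ X)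
    (hX : X ≤ ε / (4 * 12 * 27) * χ2) (hSg1 : N2 * χ2 ≤ Sg) (hSg2 : N2 ^ 2 * g ≤ Sg)
    (hρ2 : 0 < ρ2) (hg : s / 2 ≤ ρ2 * g) (hM : M = ε * s ^ 2 / (16 * 27 ^ 4) * (ρ2 ^ 2)⁻¹)
    (hT : T ≤ 12 * (N * X) * Sg + N ^ 4 * M) :
    T ≤ ε / 2 * Sg ^ 2 := by
  have hLr0 : 0 < Lr := by linarith
  have hN20 : 0 ≤ N2 := le_trans (by positivity) hN2
  have hSg0 : 0 ≤ Sg := le_trans (mul_nonneg hN20 hχ2) hSg1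
  -- the near term
  have hnear : 12 * (N * X) * Sg ≤ ε / 4 * Sg ^ 2 := by
    have h1 : N * X ≤ 27 * (ε / (4 * 12 * 27)) * Sg := by
      calc N * X ≤ (27 * Lr ^ 3) * (ε / (4 * 12 * 27) * χ2) := mul_le_mul hN hX hX0 (by positivity)
        _ = 27 * (ε / (4 * 12 * 27)) * (Lr ^ 3 * χ2) := by ring
        _ ≤ 27 * (ε / (4 * 12 * 27)) * (N2 * χ2) := by gcongr
        _ ≤ 27 * (ε / (4 * 12 * 27)) * Sg := by gcongr
    calc 12 * (N * X) * Sg ≤ 12 * (27 * (ε / (4 * 12 * 27)) * Sg) * Sg := by gcongr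
      _ = ε / 4 * Sg ^ 2 := by ring
  -- the far term
  have hfar : N ^ 4 * M ≤ ε / 4 * Sg ^ 2 := by
    have h1 : Lr ^ 6 * g ≤ Sg := by
      have hgpos : 0 < g := by
        by_contra h
        push Not at h
        nlinarith
      calc Lr ^ 6 * g = (Lr ^ 3) ^ 2 * g := by ring
        _ ≤ N2 ^ 2 * g := by gcongr
        _ ≤ Sg := hSg2
    have h2 : Lr ^ 6 * s ≤ 2 * ρ2 * Sg := by
      have h := mul_le_mul_of_nonneg_left hg (by positivity : (0 : ℝ) ≤ Lr ^ 6)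
      nlinarith
    have h3 : Lr ^ 12 * s ^ 2 ≤ 4 * ρ2 ^ 2 * Sg ^ 2 := by
      have h0 : 0 ≤ Lr ^ 6 * s := by positivity
      calc Lr ^ 12 * s ^ 2 = (Lr ^ 6 * s) * (Lr ^ 6 * s) := by ring
        _ ≤ (2 * ρ2 * Sg) * (2 * ρ2 * Sg) := mul_le_mul h2 h2 h0 (by positivity)
        _ = 4 * ρ2 ^ 2 * Sg ^ 2 := by ring
    have hN4 : N ^ 4 ≤ 27 ^ 4 * Lr ^ 12 := by
      calc N ^ 4 ≤ (27 * Lr ^ 3) ^ 4 := pow_le_pow_left₀ hN0 hN 4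
        _ = 27 ^ 4 * Lr ^ 12 := by ring
    have hM0 : 0 ≤ M := by rw [hM]; positivity
    have hρ2ne : ρ2 ^ 2 ≠ 0 := by positivity
    calc N ^ 4 * M ≤ 27 ^ 4 * Lr ^ 12 * M := mul_le_mul_of_nonneg_right hN4 hM0
      _ = ε / 16 * ((Lr ^ 12 * s ^ 2) * (ρ2 ^ 2)⁻¹) := by rw [hM]; ring
      _ ≤ ε / 16 * ((4 * ρ2 ^ 2 * Sg ^ 2) * (ρ2 ^ 2)⁻¹) := by gcongr
      _ = ε / 4 * Sg ^ 2 := by field_simp; ring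
  linarith

/-! ### The composition: the three stub statements give the crux

Two spellings of the same real proof: `GaussianLimitKillsBlockCoupling_of_hyps` takes the three stub STATEMENTS
as explicit hypotheses and concludes the crux's definiens (sorry-free; axioms `propext / Classical.choice /
Quot.sound`); `GaussianLimitKillsBlockCoupling_of` feeds it the three declared stubs and concludes the crux BY
NAME (no hypotheses, `sorry` only inside `stub_*`). -/

/-- **The crux statement from the three stub statements** (hypotheses = the statements of
`stub_nearFarPairingSplit`, `stub_shortDistanceNonDomination`, `stub_farUrsellVanishing`, verbatim;
conclusion = the definiens of `GaussianLimitKillsBlockCoupling`; real proof, no `sorry`). The dimension count: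
`|3Σ_L² − ⟨M_L⁴⟩| ≤ Σ|U₄^{lat}|` (tree identity); split at `n = ⌊ηL⌋` (stub 1) with row sums `≤ χ(n)`; near
part `/Σ_L² ≤ 324·χ(⌊ηL⌋)/χ(L/2) ≤ ε/4` by stub 2 and `Σ_L ≥ |Λ_{L/2}|χ(L/2)`; far part `/Σ_L² ≤ ε/4` by stub 3
and `Σ_L ≥ |Λ_{L/2}|²G(2Le₁) ≥ L⁶·(s/2)ρ(1/L)⁻²` (`ρ(1/L)²G(2Le₁) → s = S₂(0,2e) > 0`). -/
theorem GaussianLimitKillsBlockCoupling_of_hyps :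
    (∀ (L n : ℕ) (X M : ℝ), 0 ≤ M →
      (∀ u : Literature.Probability.LatticeModels.Site 3,
        ∑ v ∈ (Literature.Probability.LatticeModels.box 3 L).filter (fun v => Literature.Probability.LatticeModels.Site.supNorm (v - u) ≤ n),
          Literature.Probability.LatticeModels.criticalCorr 3 2 ![u, v] ≤ X) →
      (∀ a ∈ Literature.Probability.LatticeModels.box 3 L, ∀ b ∈ Literature.Probability.LatticeModels.box 3 L, ∀ c ∈ Literature.Probability.LatticeModels.box 3 L, ∀ e ∈ Literature.Probability.LatticeModels.box 3 L,
        n < Literature.Probability.LatticeModels.Site.supNorm (b - a) → n < Literature.Probability.LatticeModels.Site.supNorm (e - c) →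
        n < Literature.Probability.LatticeModels.Site.supNorm (c - a) → n < Literature.Probability.LatticeModels.Site.supNorm (e - b) →
        n < Literature.Probability.LatticeModels.Site.supNorm (e - a) → n < Literature.Probability.LatticeModels.Site.supNorm (c - b) →
        |Literature.Probability.LatticeModels.criticalCorr 3 4 ![a, b, c, e] -
          (Literature.Probability.LatticeModels.criticalCorr 3 2 ![a, b] * Literature.Probability.LatticeModels.criticalCorr 3 2 ![c, e] +
            Literature.Probability.LatticeModels.criticalCorr 3 2 ![a, c] * Literature.Probability.LatticeModels.criticalCorr 3 2 ![b, e] +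
            Literature.Probability.LatticeModels.criticalCorr 3 2 ![a, e] * Literature.Probability.LatticeModels.criticalCorr 3 2 ![b, c])| ≤ M) →
      ∑ a ∈ Literature.Probability.LatticeModels.box 3 L, ∑ b ∈ Literature.Probability.LatticeModels.box 3 L, ∑ c ∈ Literature.Probability.LatticeModels.box 3 L, ∑ e ∈ Literature.Probability.LatticeModels.box 3 L,
          |Literature.Probability.LatticeModels.criticalCorr 3 4 ![a, b, c, e] -
          (Literature.Probability.LatticeModels.criticalCorr 3 2 ![a, b] * Literature.Probability.LatticeModels.criticalCorr 3 2 ![c, e] +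
            Literature.Probability.LatticeModels.criticalCorr 3 2 ![a, c] * Literature.Probability.LatticeModels.criticalCorr 3 2 ![b, e] +
            Literature.Probability.LatticeModels.criticalCorr 3 2 ![a, e] * Literature.Probability.LatticeModels.criticalCorr 3 2 ![b, c])| ≤
        12 * ((Finset.card (Literature.Probability.LatticeModels.box 3 L) : ℝ) * X) *
            (∑ a ∈ Literature.Probability.LatticeModels.box 3 L, ∑ b ∈ Literature.Probability.LatticeModels.box 3 L, Literature.Probability.LatticeModels.criticalCorr 3 2 ![a, b]) +
          (Finset.card (Literature.Probability.LatticeModels.box 3 L) : ℝ) ^ 4 * M) →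
    (∀ (ρ : ℝ → ℝ) (Δ : ℝ) (S : Literature.Probability.LatticeModels.CorrFamily 3), (∀ δ ∈ Set.Ioc (0:ℝ) 1, 0 < ρ δ) →
      Literature.Probability.LatticeModels.HasPointwiseScalingLimit (Literature.Probability.LatticeModels.criticalCorr 3) ρ S →
      Literature.Probability.LatticeModels.IsNondegenerateTwoPoint S → Literature.Probability.LatticeModels.IsScaleCovariant Δ S →
      ∀ ε : ℝ, 0 < ε → ∃ η : ℝ, 0 < η ∧ η ≤ 1 ∧ ∀ᶠ L : ℕ in Filter.atTop,
        ∑ z ∈ Literature.Probability.LatticeModels.box 3 ⌊η * L⌋₊, Literature.Probability.LatticeModels.criticalTwoPoint 3 z ≤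
          ε * ∑ z ∈ Literature.Probability.LatticeModels.box 3 (L / 2), Literature.Probability.LatticeModels.criticalTwoPoint 3 z) →
    (∀ (ρ : ℝ → ℝ) (S : Literature.Probability.LatticeModels.CorrFamily 3),
      Literature.Probability.LatticeModels.HasPointwiseScalingLimit (Literature.Probability.LatticeModels.criticalCorr 3) ρ S → ¬ Literature.Probability.LatticeModels.HasNontrivialU4 S →
      ∀ η ε : ℝ, 0 < η → 0 < ε →
      ∀ᶠ L : ℕ in Filter.atTop, ∀ y : Fin 4 → Literature.Probability.LatticeModels.Site 3, (∀ i, y i ∈ Literature.Probability.LatticeModels.box 3 L) →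
        (∀ i j, i ≠ j → η * L < Literature.Probability.LatticeModels.Site.supNorm (y i - y j)) →
        ρ (1 / (L : ℝ)) ^ 4 * |Literature.Probability.LatticeModels.criticalCorr 3 4 y -
          (Literature.Probability.LatticeModels.criticalCorr 3 2 ![y 0, y 1] * Literature.Probability.LatticeModels.criticalCorr 3 2 ![y 2, y 3]
            + Literature.Probability.LatticeModels.criticalCorr 3 2 ![y 0, y 2] * Literature.Probability.LatticeModels.criticalCorr 3 2 ![y 1, y 3]
            + Literature.Probability.LatticeModels.criticalCorr 3 2 ![y 0, y 3] * Literature.Probability.LatticeModels.criticalCorr 3 2 ![y 1, y 2])| ≤ ε) →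
    ∀ (ρ : ℝ → ℝ) (Δ : ℝ) (S : Literature.Probability.LatticeModels.CorrFamily 3), (∀ δ ∈ Set.Ioc (0:ℝ) 1, 0 < ρ δ) →
      Literature.Probability.LatticeModels.HasPointwiseScalingLimit (Literature.Probability.LatticeModels.criticalCorr 3) ρ S → Literature.Probability.LatticeModels.IsNondegenerateTwoPoint S →
      Literature.Probability.LatticeModels.IsScaleCovariant Δ S → ¬ Literature.Probability.LatticeModels.HasNontrivialU4 S →
      Filter.Tendsto (fun L : ℕ => (3 * (Literature.Probability.LatticeModels.plusExpect 3 (Literature.Probability.LatticeModels.criticalBeta 3) 0 (fun σ => (∑ x ∈ Literature.Probability.LatticeModels.box 3 L, Literature.Probability.LatticeModels.spinAt x σ) ^ 2)) ^ 2 - Literature.Probability.LatticeModels.plusExpect 3 (Literature.Probability.LatticeModels.criticalBeta 3) 0 (fun σ => (∑ x ∈ Literature.Probability.LatticeModels.box 3 L, Literature.Probability.LatticeModels.spinAt x σ) ^ 4)) / (Literature.Probability.LatticeModels.plusExpect 3 (Literature.Probability.LatticeModels.criticalBeta 3) 0 (fun σ => (∑ x ∈ Literature.Probability.LatticeModels.box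 3 L, Literature.Probability.LatticeModels.spinAt x σ) ^ 2)) ^ 2) Filter.atTop (nhds 0) := by
  intro hSplit hDbl hFar ρ Δ S hρ hlim hnd hsc hU4
  classical
  -- notation: `Sg L = Σ_L`, the lattice Ursell function `U`, the box two-point sum `χ`
  obtain ⟨Sg, hSg⟩ : ∃ Sg : ℕ → ℝ, ∀ L, Sg L =
      plusExpect 3 (criticalBeta 3) 0 (fun σ => (∑ x ∈ box 3 L, spinAt x σ) ^ 2) := ⟨_, fun _ => rfl⟩
  obtain ⟨U, hU⟩ : ∃ U : Site 3 → Site 3 → Site 3 → Site 3 → ℝ, ∀ a b c e, U a b c e =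
      criticalCorr 3 4 ![a, b, c, e] -
        (criticalCorr 3 2 ![a, b] * criticalCorr 3 2 ![c, e] +
          criticalCorr 3 2 ![a, c] * criticalCorr 3 2 ![b, e] +
          criticalCorr 3 2 ![a, e] * criticalCorr 3 2 ![b, c]) := ⟨_, fun _ _ _ _ => rfl⟩
  obtain ⟨χ, hχ⟩ : ∃ χ : ℕ → ℝ, ∀ m, χ m = ∑ z ∈ box 3 m, criticalTwoPoint 3 z := ⟨_, fun _ => rfl⟩
  -- the numerator is `-Σ U` and `|numerator| ≤ Σ |U|`
  have hnum : ∀ L : ℕ, |3 * Sg L ^ 2 -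
      plusExpect 3 (criticalBeta 3) 0 (fun σ => (∑ x ∈ box 3 L, spinAt x σ) ^ 4)| ≤
      ∑ a ∈ box 3 L, ∑ b ∈ box 3 L, ∑ c' ∈ box 3 L, ∑ e ∈ box 3 L, |U a b c' e| := by
    intro L
    rw [hSg, three_mul_sq_sub_fourth_eq_neg_sum_ursellFour 3 L, abs_neg]
    simp only [← hU]
    refine (Finset.abs_sum_le_sum_abs _ _).trans (Finset.sum_le_sum fun a _ => ?_)
    refine (Finset.abs_sum_le_sum_abs _ _).trans (Finset.sum_le_sum fun b _ => ?_)
    refine (Finset.abs_sum_le_sum_abs _ _).trans (Finset.sum_le_sum fun c _ => ?_)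
    exact Finset.abs_sum_le_sum_abs _ _
  -- six separations `‖yᵢ - yⱼ‖_∞ > ηL` (`i < j`) give all twelve ordered ones
  have hsix : ∀ {t : ℝ} {y : Fin 4 → Site 3},
      t < Site.supNorm (y 0 - y 1) → t < Site.supNorm (y 0 - y 2) →
      t < Site.supNorm (y 0 - y 3) → t < Site.supNorm (y 1 - y 2) →
      t < Site.supNorm (y 1 - y 3) → t < Site.supNorm (y 2 - y 3) →
      ∀ i j : Fin 4, i ≠ j → t < Site.supNorm (y i - y j) := by
    intro t y h01 h02 h03 h12 h13 h23 i j hij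
    fin_cases i <;> fin_cases j <;> first
      | exact absurd rfl hij
      | assumption
      | (rw [Site.supNorm_sub_comm]; assumption)
  -- `Σ_L` as a pair sum
  have hSgsum : ∀ L, Sg L = ∑ a ∈ box 3 L, ∑ b ∈ box 3 L, criticalCorr 3 2 ![a, b] := fun L => by
    rw [hSg, plusExpect_blockSpin_sq_eq_sum 3 L]
  -- the reference value `s = S₂(0, 2e) > 0` and the limit at the exact lattice pair `(0, 2Le₁)`
  have hspos : 0 < S 2 ![0, EuclideanSpace.single (0 : Fin 3) ((2 : ℕ) : ℝ)] :=
    hnd _ (zero_unitVec_mem_nonCoincident (by norm_num))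
  have hpt := tendsto_renorm_sq_mul_axis_two hlim
  obtain ⟨s, hs⟩ : ∃ s : ℝ, S 2 ![0, EuclideanSpace.single (0 : Fin 3) ((2 : ℕ) : ℝ)] = s := ⟨_, rfl⟩
  rw [hs] at hspos hpt
  have hptL : ∀ᶠ L : ℕ in atTop,
      s / 2 < ρ (1 / (L : ℝ)) ^ 2 * criticalTwoPoint 3 (Pi.single 0 ((2 * L : ℕ) : ℤ)) :=
    hpt.eventually_const_lt (half_lt_self hspos)
  rw [Metric.tendsto_nhds]
  intro ε hε
  -- stub 2 (short distances do not dominate) fixes `η`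
  obtain ⟨η, hηpos, -, hdblL⟩ := hDbl ρ Δ S hρ hlim hnd hsc (ε / (4 * 12 * 27)) (by positivity)
  -- stub 3 (far smallness under the Gaussian limit)
  obtain ⟨ε', hε'def⟩ : ∃ ε' : ℝ, ε' = ε * s ^ 2 / (16 * 27 ^ 4) := ⟨_, rfl⟩
  have hε'pos : 0 < ε' := by rw [hε'def]; positivity
  have hfarL := hFar ρ S hlim hU4 η ε' hηpos hε'pos
  filter_upwards [hfarL, hptL, hdblL, eventually_ge_atTop 1] with L hfar hptv hdbl hL1
  rw [Real.dist_eq, sub_zero]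
  -- real bookkeeping at this `L`
  have hLr : (1 : ℝ) ≤ L := by exact_mod_cast hL1
  have hLr0 : (0 : ℝ) < L := by positivity
  have hρpos : 0 < ρ (1 / (L : ℝ)) :=
    hρ _ ⟨by positivity, by rw [div_le_one hLr0]; exact hLr⟩
  obtain ⟨ρ2, hρ2⟩ : ∃ ρ2 : ℝ, ρ (1 / (L : ℝ)) ^ 2 = ρ2 := ⟨_, rfl⟩
  have hρ2pos : 0 < ρ2 := by rw [← hρ2]; exact pow_pos hρpos 2
  rw [hρ2] at hptv
  -- the far bound `M`
  obtain ⟨M, hMdef⟩ : ∃ M : ℝ, M = ε' * (ρ2 ^ 2)⁻¹ := ⟨_, rfl⟩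
  have hM0 : 0 ≤ M := by rw [hMdef]; positivity
  set n : ℕ := ⌊η * L⌋₊ with hn
  have hconv : ∀ u v : Site 3, n < Site.supNorm (v - u) →
      η * L < Site.supNorm (u - v) ∧ η * L < Site.supNorm (v - u) := by
    intro u v h
    have h' : (n : ℝ) + 1 ≤ Site.supNorm (v - u) := by exact_mod_cast h
    have hfl : η * L < (n : ℝ) + 1 := Nat.lt_floor_add_one _
    rw [Site.supNorm_sub_comm u v]
    exact ⟨by linarith, by linarith⟩
  have hfarM : ∀ a ∈ box 3 L, ∀ b ∈ box 3 L, ∀ c' ∈ box 3 L, ∀ e ∈ box 3 L,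
      n < Site.supNorm (b - a) → n < Site.supNorm (e - c') → n < Site.supNorm (c' - a) →
      n < Site.supNorm (e - b) → n < Site.supNorm (e - a) → n < Site.supNorm (c' - b) →
      |criticalCorr 3 4 ![a, b, c', e] -
        (criticalCorr 3 2 ![a, b] * criticalCorr 3 2 ![c', e] +
          criticalCorr 3 2 ![a, c'] * criticalCorr 3 2 ![b, e] +
          criticalCorr 3 2 ![a, e] * criticalCorr 3 2 ![b, c'])| ≤ M := by
    intro a ha b hb c' hc e he h1 h2 h3 h4 h5 h6
    have hy := hfar ![a, b, c', e] (fun i => by fin_cases i <;> assumption)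
      (hsix (by simpa using (hconv _ _ h1).1) (by simpa using (hconv _ _ h3).1)
        (by simpa using (hconv _ _ h5).1) (by simpa using (hconv _ _ h6).1)
        (by simpa using (hconv _ _ h4).1) (by simpa using (hconv _ _ h2).1))
    simp only [Matrix.cons_val_zero, Matrix.cons_val_one, Matrix.cons_val] at hy
    -- `hy : ρ(1/L)⁴ |U| ≤ ε'`
    have hρ4eq : ρ (1 / (L : ℝ)) ^ 4 = ρ2 ^ 2 := by rw [← hρ2]; ring
    rw [hρ4eq] at hy
    have hρ4 : 0 < ρ2 ^ 2 := pow_pos hρ2pos 2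
    rw [hMdef]
    calc _ = (ρ2 ^ 2)⁻¹ * (ρ2 ^ 2 * |criticalCorr 3 4 ![a, b, c', e] -
          (criticalCorr 3 2 ![a, b] * criticalCorr 3 2 ![c', e] +
            criticalCorr 3 2 ![a, c'] * criticalCorr 3 2 ![b, e] +
            criticalCorr 3 2 ![a, e] * criticalCorr 3 2 ![b, c'])|) := by
          rw [← mul_assoc, inv_mul_cancel₀ hρ4.ne', one_mul]
      _ ≤ (ρ2 ^ 2)⁻¹ * ε' := mul_le_mul_of_nonneg_left hy (inv_nonneg.2 hρ4.le)
      _ = ε' * (ρ2 ^ 2)⁻¹ := mul_comm _ _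
  -- stub 1: the near/far split at this `L`, with the row-sum bound `χ n`
  have hT := hSplit L n (χ n) M hM0 (fun u => by rw [hχ]; exact rowSum_le_boxSum L n u) hfarM
  simp only [← hU] at hT
  rw [← hSgsum] at hT
  -- inputs of the arithmetic
  have hN := card_box_le L hL1
  have hN2 := pow_three_le_card_box_half L
  have hSg1 : (#(box 3 (L / 2)) : ℝ) * χ (L / 2) ≤ Sg L := by
    rw [hχ, hSgsum]; exact card_mul_boxSum_le_blockSum L
  have hSg2 : (#(box 3 (L / 2)) : ℝ) ^ 2 * criticalTwoPoint 3 (Pi.single 0 ((2 * L : ℕ) : ℤ)) ≤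
      Sg L := by
    rw [hSgsum]; exact card_sq_mul_axis_le_blockSum L
  have hX : χ n ≤ ε / (4 * 12 * 27) * χ (L / 2) := by rw [hχ, hχ]; exact hdbl
  have hχ2 : 0 ≤ χ (L / 2) := by rw [hχ]; exact boxSum_nonneg _
  have hX0 : 0 ≤ χ n := by rw [hχ]; exact boxSum_nonneg _
  have hTle := birth_arith hε hspos hLr (Nat.cast_nonneg _) hN hN2 hχ2 hX0 hX hSg1 hSg2 hρ2pos
    hptv.le (by rw [hMdef, hε'def]) hT
  -- positivity of `Σ_L`
  have hSpos : 0 < Sg L := by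
    have h1 : (1 : ℝ) ≤ χ (L / 2) := by rw [hχ]; exact one_le_boxSum _
    have h3 : (1 : ℝ) ≤ (L : ℝ) ^ 3 := one_le_pow₀ hLr
    calc (0 : ℝ) < 1 := one_pos
      _ ≤ (#(box 3 (L / 2)) : ℝ) * χ (L / 2) := by nlinarith
      _ ≤ Sg L := hSg1
  -- conclusion
  rw [← hSg, abs_div, abs_of_pos (pow_pos hSpos 2), div_lt_iff₀ (pow_pos hSpos 2)]
  calc |3 * Sg L ^ 2 - plusExpect 3 (criticalBeta 3) 0 (fun σ => (∑ x ∈ box 3 L, spinAt x σ) ^ 4)|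
      ≤ ∑ a ∈ box 3 L, ∑ b ∈ box 3 L, ∑ c' ∈ box 3 L, ∑ e ∈ box 3 L, |U a b c' e| := hnum L
    _ ≤ ε / 2 * Sg L ^ 2 := hTle
    _ < ε * Sg L ^ 2 := by nlinarith [pow_pos hSpos 2]

/-- **The crux `GaussianLimitKillsBlockCoupling` BY NAME from the three declared stubs** (route
`LocalisationClock`, item stmt-CriticalPhenomena-15886) — the skeleton's concluding declaration. Its only
debts are the `sorry`s inside `stub_nearFarPairingSplit`, `stub_shortDistanceNonDomination`,
`stub_farUrsellVanishing`; the composition itself is `GaussianLimitKillsBlockCoupling_of_hyps`. -/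
theorem GaussianLimitKillsBlockCoupling_of :
    Summit.CriticalPhenomena.Ising3DConformalLimit.Theses.LocalisationClock.GaussianLimitKillsBlockCoupling :=
  GaussianLimitKillsBlockCoupling_of_hyps stub_nearFarPairingSplit stub_shortDistanceNonDomination
    stub_farUrsellVanishing

end Summit.CriticalPhenomena.Ising3DConformalLimit.Cruxes.GaussianLimitKillsBlockCoupling.Birth

end
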